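import Summits.HubbardSuperconductivity.HubbardLadder.PairCorrWindowUniform
import Literature.MathematicalPhysics.QuantumLattice.HubbardNNNHoppingThermodynamicLimit
import HarnessLib

/-!
# R3-∞ / R4: the typed thermodynamic-limit TARGETS fed by translation-invariant pair-correlator
# window certificates, with every hypothesis discharged to certificate data

HONEST FRAMING: ladder R1–R4 with certified numbers; no claim on H/H₀.

`PairCorrWindowUniform.lean` proves that ONE translation-invariant window certificate
`C : PairWindowCertTT' t t' U r ε` bounds `ε · P̄_d(L, r; ψ)` from below by
`C.bound L n = C.q + (Σ_σ μ_σ)(n/L² − ν)` for every unit ground state `ψ` of every large torus, given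
the per-torus energy ceiling `E₀(2n)/L² ≤ C.u`. This file removes the two `L`-dependent inputs:

* §1 the energy ceiling: `uniformEnergyCeiling_of_energyDensityTT'_lt` — any `u` strictly above the
  thermodynamic-limit energy density `e(t, t', U, 1 − δ)` (Literature `energyDensityTT'`, whose
  certified UPPER rows are rung R1 of the ladder) is a uniform ceiling at the summit filling
  `electronNumber δ L` from some `L₀` on (`tendsto_energyDensityTT'_torus`);
* §2 the density term: with `ν = (1 − δ)/2`, `|C.bound L (pairNumber δ L) − C.q| ≤ |Σ_σ μ_σ| / L²`
  (`abs_bound_sub_q_le`), hence `C.bound → C.q` and `b < C.q ⇒ b ≤ C.bound` on all large tori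
  (`bound_ge_eventually`);
* §3 the typed TARGETS, now pure statements about certificate DATA (OPEN — no certificate has been
  computed; by the cell's R3 design memo §5 the affordable relaxation levels are 2–4 orders of
  magnitude too weak to decide a sign): `R3InfinityPositiveRowCert t' r` — a lower certificate at
  `(t, t', U) = (1, t', 8)`, displacement `r`, with `ν = 7/16`, energy ceiling above `e(1, t', 8, 7/8)`
  and `q > 0`; consequence `avgPairCorr_ge_eventually_of_row`: `P̄_d(L, r; ψ) ≥ q/2 > 0` for EVERY unit
  sector ground state of EVERY large torus at doping `1/8` (a uniform-in-`L`, TL-ready statement for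
  one displacement); `R3InfinityDichotomyCert r` — four certificates (`t' = 0` lower/upper, `t' = −1/4`
  lower/upper) with `max |q_lo⁰| |q_hi⁰| < q_lo^{−1/4}`; consequence
  `finiteDichotomy_eventually_of_R3InfinityDichotomy`: the R3 `FiniteDichotomyCert` on EVERY large
  torus.

Result line (cell brief (iii)), exactly: no certificate instance has been run; nothing is certified at
any size by this file; these are typed targets and their proved consequences only.

References: Wang et al., PRX 14 (2024) 031006 §III [cite: WangEtAl2024, §III]; Han, arXiv:2006.06002
§3 [cite: Han2020Bootstrap, §3]; Qin et al., PRX 10 (2020) 031016 §II [cite: QinEtAl2020, §II eqs. (2)–(4)];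
Ruelle, Statistical Mechanics (1969) §3.3 [cite: Ruelle1969, §3.3].
-/

namespace Summit.HubbardSuperconductivity.HubbardLadder

open Matrix Finset Filter Topology Literature.Probability.LatticeModels
  Literature.MathematicalPhysics.QuantumLattice
open Literature.MathematicalPhysics.QuantumLattice.ThermodynamicLimit
open scoped ComplexOrder

noncomputable section

/-! ## §1 Fillings, capacities, and the energy ceiling from the thermodynamic-limit energy density -/

/-- The summit's pair number at doping `δ`: `electronNumber δ L = 2 · pairNumber δ L`. [folklore] -/
def pairNumber (δ : ℝ) (L : ℕ) : ℕ := ⌊(1 - δ) * (L : ℝ) ^ 2 / 2⌋₊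

/-- `electronNumber δ L = 2 · pairNumber δ L`. [folklore] -/
theorem electronNumber_eq (δ : ℝ) (L : ℕ) : electronNumber δ L = 2 * pairNumber δ L := rfl

/-- The summit's filling is the Literature filling `rectN (1 − δ)` of the TL energy density.
[cite: Ruelle1969, §3.3] -/
theorem electronNumber_eq_rectN (δ : ℝ) (L : ℕ) : electronNumber δ L = rectN (1 - δ) L := rfl

/-- Capacity: `pairNumber δ L ≤ |𝕋_L|` for `δ ≥ -1`. [folklore] -/
theorem pairNumber_le_card {δ : ℝ} (hδ : -1 ≤ δ) (L : ℕ) :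
    pairNumber δ L ≤ Fintype.card (FermionTorus 2 L) := by
  rw [NoGo.card_fermionTorus_two]
  exact NoGo.floor_pairNumber_le δ hδ L

/-- The pair number is within one of half the target density: `(1 − δ)L² − 2 < 2·pairNumber ≤ (1 − δ)L²`
(`δ ≤ 1`). [folklore] -/
theorem two_mul_pairNumber_bounds {δ : ℝ} (hδ : δ ≤ 1) (L : ℕ) :
    (1 - δ) * (L : ℝ) ^ 2 - 2 < 2 * (pairNumber δ L : ℝ) ∧
      2 * (pairNumber δ L : ℝ) ≤ (1 - δ) * (L : ℝ) ^ 2 := by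
  have e1 : (rectN (1 - δ) L : ℝ) = 2 * (pairNumber δ L : ℝ) := by
    rw [show rectN (1 - δ) L = 2 * pairNumber δ L from rfl]; push_cast; ring
  have h1 := rectN_le (n := 1 - δ) (by linarith) L
  have h2 := lt_rectN_add_two (1 - δ) L
  rw [e1] at h1 h2
  exact ⟨by linarith, h1⟩

/-- **The energy-ceiling hypothesis discharged from the TL energy density.** For `U ≥ 0`, `-1 < δ ≤ 1`
and any `u > e(t, t', U, 1 − δ)` there is `L₀` with
`groundEnergy (hubbardTorusTT' L t t' U) (electronNumber δ L) / L² ≤ u` for all `L ≥ L₀` — so the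
energy constraint of a window certificate may use ANY ceiling strictly above a certified TL upper row
of rung R1. (`tendsto_energyDensityTT'_torus`.) [cite: Ruelle1969, §3.3] -/
theorem uniformEnergyCeiling_of_energyDensityTT'_lt {t t' U : ℝ} (hU : 0 ≤ U) {δ : ℝ} (hδ0 : -1 < δ)
    (hδ1 : δ ≤ 1) {u : ℝ} (hu : energyDensityTT' t t' U (1 - δ) < u) :
    ∃ L₀ : ℕ, ∀ L : ℕ, L₀ ≤ L →
      groundEnergy (hubbardTorusTT' L t t' U) (electronNumber δ L) / (L : ℝ) ^ 2 ≤ u := by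
  have h := (tendsto_energyDensityTT'_torus t t' hU (n := 1 - δ) (by linarith) (by linarith)).eventually_lt_const hu
  obtain ⟨L₀, hL₀⟩ := Filter.eventually_atTop.1 h
  exact ⟨L₀, fun L hL => by rw [electronNumber_eq_rectN]; exact (hL₀ L hL).le⟩

/-- Archimedean helper: `M/L² < g` on all large sides. [folklore] -/
private theorem exists_forall_div_sq_lt (M : ℝ) {g : ℝ} (hg : 0 < g) :
    ∃ L₀ : ℕ, ∀ L : ℕ, L₀ ≤ L → 1 ≤ L ∧ M / (L : ℝ) ^ 2 < g := by
  obtain ⟨L₀, hL₀⟩ := exists_nat_gt (M / g)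
  refine ⟨L₀ + 1, fun L hL => ⟨le_trans (Nat.le_add_left 1 L₀) hL, ?_⟩⟩
  have hLr : (L₀ : ℝ) + 1 ≤ L := by exact_mod_cast hL
  have hL1 : (1 : ℝ) ≤ L := by linarith [(Nat.cast_nonneg L₀ : (0 : ℝ) ≤ L₀)]
  have hL2 : (0 : ℝ) < (L : ℝ) ^ 2 := by positivity
  rw [div_lt_iff₀ hL2]
  rw [div_lt_iff₀ hg] at hL₀
  have hLL : (L : ℝ) ≤ (L : ℝ) ^ 2 := by nlinarith
  have h1 : (L₀ : ℝ) * g < (L : ℝ) * g := by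
    have : (L₀ : ℝ) < L := by linarith
    exact mul_lt_mul_of_pos_right this hg
  nlinarith [mul_le_mul_of_nonneg_right hLL hg.le]

namespace PairWindowCertTT'

variable {t t' U : ℝ} {r : Site 2} {ε : ℝ}

/-! ## §2 The density term: `bound L (pairNumber δ L) → q` at rate `|Σμ|/L²` when `ν = (1 − δ)/2` -/

/-- **Rate**: with `ν = (1 − δ)/2` (`δ ≤ 1`), `|bound L (pairNumber δ L) − q| ≤ |Σ_σ μ_σ| / L²` for
every `L ≥ 1`. [folklore] -/
theorem abs_bound_sub_q_le (C : PairWindowCertTT' t t' U r ε) {δ : ℝ} (hδ : δ ≤ 1)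
    (hν : C.ν = (1 - δ) / 2) {L : ℕ} (hL : 1 ≤ L) :
    |C.bound L (pairNumber δ L) - C.q| ≤ |∑ σ : Fin 2, C.μ σ| / (L : ℝ) ^ 2 := by
  have hL1 : (1 : ℝ) ≤ L := by exact_mod_cast hL
  have hL2 : (0 : ℝ) < (L : ℝ) ^ 2 := by positivity
  obtain ⟨hgt, hle⟩ := two_mul_pairNumber_bounds hδ L
  have hy : |(pairNumber δ L : ℝ) - C.ν * (L : ℝ) ^ 2| ≤ 1 := by
    rw [hν, abs_le]; constructor <;> linarith
  have key : C.bound L (pairNumber δ L) - C.q =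
      (∑ σ : Fin 2, C.μ σ) * (((pairNumber δ L : ℝ) - C.ν * (L : ℝ) ^ 2) / (L : ℝ) ^ 2) := by
    unfold bound
    rw [sub_div, mul_div_cancel_right₀ _ hL2.ne']
    ring
  rw [key, abs_mul, abs_div, abs_of_pos hL2]
  calc |∑ σ : Fin 2, C.μ σ| * (|(pairNumber δ L : ℝ) - C.ν * (L : ℝ) ^ 2| / (L : ℝ) ^ 2)
      ≤ |∑ σ : Fin 2, C.μ σ| * (1 / (L : ℝ) ^ 2) := by gcongr
    _ = |∑ σ : Fin 2, C.μ σ| / (L : ℝ) ^ 2 := by ring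

/-- **Eventually above any `b < q`.** [folklore] -/
theorem bound_ge_eventually (C : PairWindowCertTT' t t' U r ε) {δ : ℝ} (hδ : δ ≤ 1)
    (hν : C.ν = (1 - δ) / 2) {b : ℝ} (hb : b < C.q) :
    ∃ L₀ : ℕ, ∀ L : ℕ, L₀ ≤ L → b ≤ C.bound L (pairNumber δ L) := by
  obtain ⟨L₀, hL₀⟩ := exists_forall_div_sq_lt |∑ σ : Fin 2, C.μ σ| (sub_pos.2 hb)
  refine ⟨L₀, fun L hL => ?_⟩
  obtain ⟨hL1, hlt⟩ := hL₀ L hL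
  have h := (abs_le.1 (C.abs_bound_sub_q_le hδ hν hL1)).1
  linarith

/-- **Eventually below `|q|` plus any margin**: `|bound L (pairNumber δ L)| < |q| + g` once
`|Σμ|/L² < g`. [folklore] -/
theorem abs_bound_lt_of_div_sq_lt (C : PairWindowCertTT' t t' U r ε) {δ : ℝ} (hδ : δ ≤ 1)
    (hν : C.ν = (1 - δ) / 2) {L : ℕ} (hL : 1 ≤ L) {g : ℝ}
    (hg : |∑ σ : Fin 2, C.μ σ| / (L : ℝ) ^ 2 < g) :
    |C.bound L (pairNumber δ L)| < |C.q| + g := by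
  have h := C.abs_bound_sub_q_le hδ hν hL
  have h2 := abs_sub_abs_le_abs_sub (C.bound L (pairNumber δ L)) C.q
  linarith

end PairWindowCertTT'

/-! ## §3 Typed thermodynamic-limit targets (OPEN) and their proved consequences -/

/-- **Target R3-∞⁺ (OPEN: the target is `Nonempty (R3InfinityPositiveRowCert t' r)`).** A
translation-invariant LOWER certificate for `Δ_0† Δ_r` in the `t–t'`
model `(t, t', U) = (1, t', 8)` at displacement `r`, with density offset `ν = 7/16` (doping `1/8`),
energy ceiling `u` strictly above the TL energy density `e(1, t', 8, 7/8)`, and POSITIVE constant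
`q = c − Σ‖aₖ‖ > 0`. A statement about certificate data only. No such certificate has been computed;
the cell's design memo (§5) estimates the affordable relaxation levels to be orders of magnitude too
weak. [cite: WangEtAl2024, §III] -/
structure R3InfinityPositiveRowCert (t' : ℝ) (r : Site 2) where
  /-- the lower certificate for `Δ_0† Δ_r` at `(1, t', 8)` -/
  C : PairWindowCertTT' 1 t' 8 r 1
  /-- density offset of doping `1/8` -/
  hν : C.ν = 7 / 16
  /-- its energy ceiling lies strictly above the TL energy density -/
  hu : energyDensityTT' 1 t' 8 (7 / 8) < C.u
  /-- its constant is positive -/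
  hq : 0 < C.q

/-- **What R3-∞⁺ would certify**: the translation-averaged `d`-wave pair correlator at displacement
`r` is `≥ q/2 > 0` in EVERY unit sector ground state of EVERY large torus at doping `1/8` — a
uniform-in-`L` (thermodynamic-limit-ready) statement, for one displacement.
[cite: Scalapino1995, §2 eq. (2.4)] -/
theorem avgPairCorr_ge_eventually_of_row {t' : ℝ} {r : Site 2} (h : R3InfinityPositiveRowCert t' r) :
    ∃ b : ℝ, 0 < b ∧ ∃ L₁ : ℕ, ∀ m : ℕ, L₁ ≤ m + 1 →
      ∀ ψ : Fock (Orb (FermionTorus 2 (m + 1))), star ψ ⬝ᵥ ψ = 1 →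
        IsGroundStateInSector (hubbardTorusTT' (m + 1) 1 t' 8) (electronNumber (1 / 8) (m + 1)) 0 ψ →
          b ≤ avgPairCorr (m + 1) r ψ := by
  obtain ⟨C, hν, hu, hq⟩ := h
  have hδ1 : (1 / 8 : ℝ) ≤ 1 := by norm_num
  have hν' : C.ν = (1 - 1 / 8) / 2 := by rw [hν]; norm_num
  have hu' : energyDensityTT' 1 t' 8 (1 - 1 / 8) < C.u := by norm_num at hu ⊢; exact hu
  obtain ⟨L₀, hL₀⟩ := uniformEnergyCeiling_of_energyDensityTT'_lt (t := 1) (t' := t') (U := 8)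
    (by norm_num) (δ := 1 / 8) (by norm_num) hδ1 hu'
  obtain ⟨Lq, hLq⟩ := C.bound_ge_eventually hδ1 hν' (b := C.q / 2) (by linarith)
  obtain ⟨La, hLa⟩ := exists_forall_le_injOn_proj (thicken C.Λ' 1)
  refine ⟨C.q / 2, by linarith, max 3 (max L₀ (max Lq La)), fun m hm ψ h1 hgs => ?_⟩
  simp only [max_le_iff] at hm
  obtain ⟨h3, hL0, hLq', hLa'⟩ := hm
  have key := C.bound_le_avgPairCorr m h3 (hLa _ hLa') (pairNumber_le_card (by norm_num) (m + 1))
    (hL₀ (m + 1) hL0) hgs h1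
  rw [one_mul] at key
  exact (hLq (m + 1) hLq').trans key

/-- **Target R3-∞ dichotomy at displacement `r` (OPEN: the target is
`Nonempty (R3InfinityDichotomyCert r)`).** Four translation-invariant certificates at
doping `1/8` (`ν = 7/16`): lower and upper for `Δ_0† Δ_r` at `t' = 0`, lower and upper at
`t' = −1/4`, energy ceilings strictly above the respective TL energy densities, and SEPARATED
constants `max |q_lo⁰| |q_hi⁰| < q_lo^{−1/4}` — certificate data only.
[cite: QinEtAl2020, §II eqs. (2)–(4)] [cite: XuEtAl2024, eq. (1)] -/
structure R3InfinityDichotomyCert (r : Site 2) where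
  /-- lower / upper certificates for `Δ_0† Δ_r` in the pure model `(1, 0, 8)` -/
  Alo : PairWindowCertTT' 1 0 8 r 1
  Ahi : PairWindowCertTT' 1 0 8 r (-1)
  /-- lower / upper certificates at `t' = -1/4` -/
  Blo : PairWindowCertTT' 1 (-1 / 4) 8 r 1
  Bhi : PairWindowCertTT' 1 (-1 / 4) 8 r (-1)
  /-- density offsets of doping `1/8` -/
  hνa : Alo.ν = 7 / 16
  hνa' : Ahi.ν = 7 / 16
  hνb : Blo.ν = 7 / 16
  hνb' : Bhi.ν = 7 / 16
  /-- energy ceilings strictly above the TL energy densities -/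
  huA : energyDensityTT' 1 0 8 (7 / 8) < min Alo.u Ahi.u
  huB : energyDensityTT' 1 (-1 / 4) 8 (7 / 8) < min Blo.u Bhi.u
  /-- separation of the certified constants -/
  hsep : max |Alo.q| |Ahi.q| < Blo.q

/-- **What the R3-∞ dichotomy would certify**: a `FiniteDichotomyCert` between the pure (`t' = 0`)
and the `t' = −1/4` model at doping `1/8` and displacement `r` on EVERY large torus — from four
certificates, once. [cite: QinEtAl2020, §II eqs. (2)–(4)] -/
theorem finiteDichotomy_eventually_of_R3InfinityDichotomy {r : Site 2} (h : R3InfinityDichotomyCert r) :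
    ∃ L₁ : ℕ, ∀ m : ℕ, L₁ ≤ m + 1 →
      Nonempty (FiniteDichotomyCert (fun L => hubbardTorusTT' L 1 0 8) (fun L => hubbardTorusTT' L 1 (-1 / 4) 8)
        (electronNumber (1 / 8)) (m + 1) r) := by
  obtain ⟨Alo, Ahi, Blo, Bhi, hνa, hνa', hνb, hνb', huA, huB, hsep⟩ := h
  have hδ1 : (1 / 8 : ℝ) ≤ 1 := by norm_num
  have e78 : (1 - 1 / 8 : ℝ) = 7 / 8 := by norm_num
  have eν : ((1 - 1 / 8) / 2 : ℝ) = 7 / 16 := by norm_num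
  obtain ⟨LA0, hLA0⟩ := uniformEnergyCeiling_of_energyDensityTT'_lt (t := 1) (t' := 0) (U := 8)
    (by norm_num) (δ := 1 / 8) (by norm_num) hδ1 (u := min Alo.u Ahi.u) (e78 ▸ huA)
  obtain ⟨LB0, hLB0⟩ := uniformEnergyCeiling_of_energyDensityTT'_lt (t := 1) (t' := -1 / 4) (U := 8)
    (by norm_num) (δ := 1 / 8) (by norm_num) hδ1 (u := min Blo.u Bhi.u) (e78 ▸ huB)
  obtain ⟨LA, hLA⟩ := rows_eventually Alo Ahi (electronNumber (1 / 8)) (pairNumber (1 / 8))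
    (electronNumber_eq (1 / 8)) (pairNumber_le_card (by norm_num)) hLA0
  obtain ⟨LB, hLB⟩ := rows_eventually Blo Bhi (electronNumber (1 / 8)) (pairNumber (1 / 8))
    (electronNumber_eq (1 / 8)) (pairNumber_le_card (by norm_num)) hLB0
  -- the margin and the side from which all three density corrections are below a third of it
  set g : ℝ := Blo.q - max |Alo.q| |Ahi.q| with hg_def
  have hg : 0 < g := by rw [hg_def]; linarith
  obtain ⟨Lg, hLg⟩ := exists_forall_div_sq_lt
    (|∑ σ : Fin 2, Alo.μ σ| + |∑ σ : Fin 2, Ahi.μ σ| + |∑ σ : Fin 2, Blo.μ σ|) (half_pos hg)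
  refine ⟨max Lg (max LA LB), fun m hm => ?_⟩
  simp only [max_le_iff] at hm
  obtain ⟨hLg', hA, hB⟩ := hm
  obtain ⟨WA, hAlo, hAhi⟩ := hLA m hA
  obtain ⟨WB, hBlo, -⟩ := hLB m hB
  obtain ⟨hL1, hlt⟩ := hLg (m + 1) hLg'
  refine ⟨FiniteDichotomyCert.ofWindows WA WB ?_⟩
  rw [hAlo, hAhi, hBlo, abs_neg]
  have hL2 : (0 : ℝ) < ((m + 1 : ℕ) : ℝ) ^ 2 := by positivity
  -- each correction is below g/2
  have hsum : |∑ σ : Fin 2, Alo.μ σ| / ((m + 1 : ℕ) : ℝ) ^ 2 + |∑ σ : Fin 2, Ahi.μ σ| / ((m + 1 : ℕ) : ℝ) ^ 2 +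
      |∑ σ : Fin 2, Blo.μ σ| / ((m + 1 : ℕ) : ℝ) ^ 2 < g / 2 := by
    rw [← add_div, ← add_div]; exact hlt
  have h1 : 0 ≤ |∑ σ : Fin 2, Alo.μ σ| / ((m + 1 : ℕ) : ℝ) ^ 2 := by positivity
  have h2 : 0 ≤ |∑ σ : Fin 2, Ahi.μ σ| / ((m + 1 : ℕ) : ℝ) ^ 2 := by positivity
  have h3 : 0 ≤ |∑ σ : Fin 2, Blo.μ σ| / ((m + 1 : ℕ) : ℝ) ^ 2 := by positivity
  have ha := Alo.abs_bound_lt_of_div_sq_lt hδ1 (by rw [hνa, eν]) hL1 (g := g / 2) (by linarith)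
  have ha' := Ahi.abs_bound_lt_of_div_sq_lt hδ1 (by rw [hνa', eν]) hL1 (g := g / 2) (by linarith)
  have hb := (abs_le.1 ((Blo.abs_bound_sub_q_le hδ1 (by rw [hνb, eν]) hL1).trans (le_of_lt (by linarith :
    |∑ σ : Fin 2, Blo.μ σ| / ((m + 1 : ℕ) : ℝ) ^ 2 < g / 2)))).1
  have hmaxq : |Alo.q| ≤ max |Alo.q| |Ahi.q| := le_max_left _ _
  have hmaxq' : |Ahi.q| ≤ max |Alo.q| |Ahi.q| := le_max_right _ _
  rw [max_lt_iff]
  constructor <;> linarith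

end

end Summit.HubbardSuperconductivity.HubbardLadder
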